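import Mathlib.Analysis.SpecialFunctions.JapaneseBracket
import Mathlib.MeasureTheory.Measure.Prod
import Mathlib.MeasureTheory.Integral.Bochner.Basic
import Literature.NumberTheory.ConnesConsani2021.FrequencyKernelApproxPieces
import HarnessLib

/-!
# Separable `L²(ℝ²)`-approximation of a quadrant kernel `−2 g(ξ−η) 1_{ξ>0≥η}` at a super-polynomial rate
# (the "direct kernel estimate" of App. D Rem. 48 of Connes–Consani 2021, one quadrant, any Schwartz `g`)

RH-FREE analysis (cell `rh-crit`, sub-cell cc, seat t13; brick (A) of the last step S4b of the discharge of
the tree fact `CC2021_lemma_D47` — App. D Lemma D.1 (47) of Connes–Consani 2021, "`[H, f]` is an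
infinitesimal of infinite order" — via `isInfiniteOrder_quantizedDiff_of_frequencyKernelApprox`
(`QuantizedDiffInfiniteOrderIff`): the frequency kernel of `[H, f]` is `−2 f̂(ξ−η)(1_{ξ>0≥η} − 1_{ξ≤0<η})`,
a difference of two quadrant kernels; this file treats ONE quadrant for an ARBITRARY Schwartz function `g`
in place of `f̂`; the assembly over the two quadrants (reflection `(ξ,η) ↦ (−ξ,−η)`, `g = 𝓕 f`) and the
2-line `CC2021_lemma_D47_holds` are brick (B), a separate file).

THE ESTIMATE (App. D p. 33, arXiv chunk p0033:L24–36, and Rem. 48, L39–41: "smooth, rapidly decaying kernel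
⇒ rapid decay of the characteristic values").  For every `k` there is `C` such that for every `n` the kernel
`K(ξ,η) = −2 g(ξ−η) 1_{ξ>0} 1_{η≤0}` is within `C (n+1)^{−k}` in `L²(ℝ²)` of a separable kernel
`Σ_{i<n} aᵢ(ξ) conj(cᵢ(η))` with `aᵢ, cᵢ ∈ L²(ℝ)` (`quadrantKernel_separableApprox`).  Proof, following the
printed hint by a direct kernel estimate: with `d = 2k`, `P = 4k+2`, `m = ⌊n/(d+1)⌋` boxes of width
`h = (m+1)^{−1/2}` on the `ξ`-axis and degrees `l ≤ d`, the `m(d+1) ≤ n` separable pieces are the box-Taylor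
terms `[−2 (l!)⁻¹ (ξ−jh)^l 1_{(jh,(j+1)h]}(ξ)] · [g^{(l)}(jh−η) 1_{η≤0}]` of `FrequencyKernelApproxPieces`;
on the strip `0 < ξ ≤ mh` the pointwise error is `≤ 2C_d h^{d+1}(1+|η|)^{−1}`
(`norm_quadrantKernel_sub_boxTaylor_le`), on the tail `ξ > mh` the kernel itself is
`≤ 2M_P (1+ξ+|η|)^{−P}`; integrating (Tonelli, `∫(1+|x|)^{−2} < ∞`) gives
`‖K − K_n‖²_{L²} ≤ 4C²I m h^{2d+3} + 4M²I²(1+mh)^{2−P} ≤ (4C²I + 4M²I²)(m+1)^{−2k}`, and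
`n + 1 ≤ (d+1)(m+1)`.
WHAT THIS IS NOT: any claim about RH; not the two-quadrant assembly; nothing here bears on the truth of RH.
Theorems only; no definition, no named fact (net debt 0).
-/

noncomputable section

open MeasureTheory Complex Set Filter
open scoped Real ENNReal Nat ComplexConjugate

namespace Literature.NumberTheory.ConnesConsani2021

open Literature.Analysis.Calculus

/-! ### Zero-padding of separable kernels to `Fin n` -/

/-- RH-FREE. **Zero-padding of a separable kernel**: a separable kernel `Σ_{j∈ι} a_j(x) conj(c_j(y))` indexed by
a finite type with `|ι| ≤ n` agrees `μ⊗μ`-a.e. with one indexed by `Fin n` (pad with the zero vector of `L²`,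
whose representative vanishes a.e.) — the re-indexing used when structured families (quadrant × box × degree)
of separable pieces are counted against the rank budget `n` in App. D Rem. 48's direct kernel estimate
(cf. the tree's `approxNumber_le_of_l2Kernel_sub_fintype`, same argument at the level of kernels).
[cite: ConnesConsani2021, App. D Rem. 48 p. 33 (arXiv chunk p0033:L39–41); Connes1994, Chap. IV §2.α] -/
theorem exists_fin_separable_ae_eq {X : Type*} [MeasurableSpace X] {μ : Measure X} [SFinite μ]
    {ι : Type*} [Fintype ι] {n : ℕ} (hn : Fintype.card ι ≤ n) (a c : ι → Lp ℂ 2 μ) :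
    ∃ a' c' : Fin n → Lp ℂ 2 μ,
      (fun z : X × X => ∑ i, (a' i : X → ℂ) z.1 * conj ((c' i : X → ℂ) z.2)) =ᵐ[μ.prod μ]
        fun z => ∑ j, (a j : X → ℂ) z.1 * conj ((c j : X → ℂ) z.2) := by
  classical
  set e : ι ↪ Fin n := (Fintype.equivFin ι).toEmbedding.trans (Fin.castLEEmb hn) with he
  set a' : Fin n → Lp ℂ 2 μ := Function.extend e a 0 with ha'
  set c' : Fin n → Lp ℂ 2 μ := Function.extend e c 0 with hc'
  refine ⟨a', c', ?_⟩
  have ha'e : ∀ j, a' (e j) = a j := fun j => by rw [ha', e.injective.extend_apply]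
  have hc'e : ∀ j, c' (e j) = c j := fun j => by rw [hc', e.injective.extend_apply]
  have ha'0 : ∀ i, (¬ ∃ j, e j = i) → a' i = 0 := fun i hi => by
    rw [ha', Function.extend_apply' _ _ _ hi, Pi.zero_apply]
  have hx : ∀ᵐ x ∂μ, ∀ i : Fin n, (¬ ∃ j, e j = i) → (a' i : X → ℂ) x = 0 := by
    refine ae_all_iff.2 fun i => ?_
    by_cases hi : ∃ j, e j = i
    · exact Eventually.of_forall fun x h => (h hi).elim
    · rw [ha'0 i hi]
      filter_upwards [Lp.coeFn_zero ℂ 2 μ] with x hx0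
      exact fun _ => by rw [hx0, Pi.zero_apply]
  filter_upwards [(Measure.quasiMeasurePreserving_fst (μ := μ) (ν := μ)).ae hx] with z hz1
  rw [← Finset.sum_subset (Finset.subset_univ (Finset.univ.map e))
      (fun i _ hi => by
        have hi' : ¬ ∃ j, e j = i := fun ⟨j, hj⟩ => hi (Finset.mem_map.2 ⟨j, Finset.mem_univ _, hj⟩)
        rw [hz1 i hi', zero_mul]),
    Finset.sum_map]
  refine Finset.sum_congr rfl fun j _ => ?_
  rw [ha'e, hc'e]

/-! ### The weight `(1+|x|)^{−2}` -/

/-- RH-FREE. `∫_ℝ (1+|x|)^{−2} dx < ∞`, as a real constant `I ≥ 0` with `∫⁻ (1+|x|)^{−2} = ofReal I`.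
[folklore] (Mathlib `finite_integral_one_add_norm`) -/
private theorem exists_lintegral_inv_one_add_abs_sq :
    ∃ I : ℝ, 0 ≤ I ∧ ∫⁻ x : ℝ, ENNReal.ofReal (((1 + |x|) ^ 2)⁻¹) = ENNReal.ofReal I := by
  have hfin : ∫⁻ x : ℝ, ENNReal.ofReal ((1 + ‖x‖) ^ (-(2 : ℝ))) < ∞ :=
    finite_integral_one_add_norm (E := ℝ) (μ := volume) (by rw [Module.finrank_self]; norm_num)
  have heq : (fun x : ℝ => ENNReal.ofReal ((1 + ‖x‖) ^ (-(2 : ℝ)))) =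
      fun x : ℝ => ENNReal.ofReal (((1 + |x|) ^ 2)⁻¹) := by
    funext x
    rw [Real.norm_eq_abs, Real.rpow_neg (by positivity), Real.rpow_two]
  rw [heq] at hfin
  exact ⟨(∫⁻ x : ℝ, ENNReal.ofReal (((1 + |x|) ^ 2)⁻¹)).toReal, ENNReal.toReal_nonneg,
    (ENNReal.ofReal_toReal hfin.ne).symm⟩

/-- RH-FREE. Measurability of the weight `x ↦ ofReal ((1+|x|)^{−2})`. [folklore] -/
private theorem measurable_weight :
    Measurable fun x : ℝ => ENNReal.ofReal (((1 + |x|) ^ 2)⁻¹) :=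
  ENNReal.measurable_ofReal.comp (by fun_prop)

/-! ### Boxes on the `ξ`-axis -/

/-- RH-FREE. Every `ξ ∈ (0, mh]` lies in one of the boxes `(jh, (j+1)h]`, `j < m`. [folklore] -/
private theorem exists_box_index {h ξ : ℝ} (hh : 0 < h) (hξ : 0 < ξ) {m : ℕ} (hξm : ξ ≤ m * h) :
    ∃ j : ℕ, j < m ∧ ξ ∈ Ioc ((j : ℝ) * h) ((j : ℝ) * h + h) := by
  set J : ℕ := ⌈ξ / h⌉₊ with hJ
  have hJpos : 0 < J := Nat.ceil_pos.2 (div_pos hξ hh)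
  have hJle : J ≤ m := Nat.ceil_le.2 (by rwa [div_le_iff₀ hh])
  refine ⟨J - 1, by omega, ?_, ?_⟩
  · have h1 : (J : ℝ) < ξ / h + 1 := Nat.ceil_lt_add_one (div_pos hξ hh).le
    have h2 : ((J - 1 : ℕ) : ℝ) = (J : ℝ) - 1 := by
      rw [Nat.cast_sub (by omega), Nat.cast_one]
    rw [h2]
    have h3 : ((J : ℝ) - 1) < ξ / h := by linarith
    exact (lt_div_iff₀ hh).1 h3
  · have h1 : ξ / h ≤ J := Nat.le_ceil _
    have h2 : ((J - 1 : ℕ) : ℝ) * h + h = (J : ℝ) * h := by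
      rw [Nat.cast_sub (by omega), Nat.cast_one]; ring
    rw [h2]
    exact (div_le_iff₀ hh).1 h1

/-- RH-FREE. The boxes `(jh, (j+1)h]` are pairwise disjoint. [folklore] -/
private theorem box_index_unique {h ξ : ℝ} (hh : 0 < h) {j j' : ℕ}
    (hj : ξ ∈ Ioc ((j : ℝ) * h) ((j : ℝ) * h + h)) (hj' : ξ ∈ Ioc ((j' : ℝ) * h) ((j' : ℝ) * h + h)) :
    j = j' := by
  have h1 : (j : ℝ) * h < ((j' : ℝ) + 1) * h := by linarith [hj.1, hj'.2]
  have h2 : (j' : ℝ) * h < ((j : ℝ) + 1) * h := by linarith [hj'.1, hj.2]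
  have h1' : (j : ℝ) < (j' : ℝ) + 1 := lt_of_mul_lt_mul_right h1 hh.le
  have h2' : (j' : ℝ) < (j : ℝ) + 1 := lt_of_mul_lt_mul_right h2 hh.le
  have h1'' : j < j' + 1 := by exact_mod_cast h1'
  have h2'' : j' < j + 1 := by exact_mod_cast h2'
  omega

/-! ### The pointwise estimate and its integration (one quadrant, explicit pieces) -/

/-- RH-FREE. **Pointwise bound of the squared error** `|K − K_{m,h}|²` by a product weight
`Φ(ξ)·(1+|η|)^{−2}`: on the strip `0 < ξ ≤ mh` by the box-Taylor remainder bound `hC`, on the tail `ξ > mh` by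
the decay `hM` of `g`, zero elsewhere.  The pieces enter only through: `A j l` vanishes off the box
`(jh,(j+1)h]`, `Cf j l` vanishes on `η > 0`, and on box × `{η ≤ 0}` their product is the Taylor term.
[cite: ConnesConsani2021, App. D Lemma 47 proof p. 33 (arXiv chunk p0033:L24–36) and Rem. 48 (L39–41)] -/
theorem ofReal_normSq_quadrant_sub_pieces_le (g : SchwartzMap ℝ ℂ) (d P : ℕ) (hP : 2 ≤ P)
    {C : ℝ}
    (hC : ∀ (j : ℕ) (h ξ η : ℝ), 0 < h → ξ ∈ Ioc ((j : ℝ) * h) ((j : ℝ) * h + h) → η ≤ 0 →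
      ‖(-2) * (g : ℝ → ℂ) (ξ - η) - ∑ l ∈ Finset.range (d + 1),
          (-2) * ((((l ! : ℝ)⁻¹ * (ξ - j * h) ^ l : ℝ) : ℂ) * iteratedDeriv l g (j * h - η))‖
        ≤ 2 * C * h ^ (d + 1) * ((1 + |η|) ^ 1)⁻¹)
    {M : ℝ} (hM : ∀ w : ℝ, ‖(g : ℝ → ℂ) w‖ ≤ M * ((1 + |w|) ^ P)⁻¹)
    (m : ℕ) {h : ℝ} (hh : 0 < h)
    (A Cf : ℕ → ℕ → ℝ → ℂ)
    (hA : ∀ (j l : ℕ) (ξ : ℝ), ξ ∉ Ioc ((j : ℝ) * h) ((j : ℝ) * h + h) → A j l ξ = 0)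
    (hCf : ∀ (j l : ℕ) (η : ℝ), 0 < η → Cf j l η = 0)
    (hAC : ∀ (j l : ℕ) (ξ η : ℝ), ξ ∈ Ioc ((j : ℝ) * h) ((j : ℝ) * h + h) → η ≤ 0 →
      A j l ξ * conj (Cf j l η) =
        (-2) * ((((l ! : ℝ)⁻¹ * (ξ - j * h) ^ l : ℝ) : ℂ) * iteratedDeriv l g (j * h - η)))
    (ξ η : ℝ) :
    ENNReal.ofReal (‖(-2) * ((g : ℝ → ℂ) (ξ - η) * (if 0 < ξ ∧ η ≤ 0 then (1 : ℂ) else 0)) -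
        ∑ p : Fin m × Fin (d + 1), A p.1 p.2 ξ * conj (Cf p.1 p.2 η)‖ ^ 2)
      ≤ ((Ioc (0 : ℝ) (m * h)).indicator (fun _ => ENNReal.ofReal ((2 * C * h ^ (d + 1)) ^ 2)) ξ +
          (Ioi ((m : ℝ) * h)).indicator
            (fun ξ => ENNReal.ofReal (4 * M ^ 2 * ((1 + m * h) ^ (P - 2))⁻¹ * ((1 + |ξ|) ^ 2)⁻¹)) ξ) *
        ENNReal.ofReal (((1 + |η|) ^ 2)⁻¹) := by
  by_cases hη : η ≤ 0
  swap
  · -- `η > 0`: everything vanishes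
    have hη' : 0 < η := lt_of_not_ge hη
    have hK : (if 0 < ξ ∧ η ≤ 0 then (1 : ℂ) else 0) = 0 := if_neg fun h' => hη h'.2
    have hS : ∑ p : Fin m × Fin (d + 1), A p.1 p.2 ξ * conj (Cf p.1 p.2 η) = 0 :=
      Finset.sum_eq_zero fun p _ => by rw [hCf _ _ _ hη', map_zero, mul_zero]
    rw [hK, hS, mul_zero, mul_zero, sub_zero, norm_zero, zero_pow two_ne_zero, ENNReal.ofReal_zero]
    exact bot_le
  by_cases hξ0 : 0 < ξ
  swap
  · -- `ξ ≤ 0`: everything vanishes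
    have hK : (if 0 < ξ ∧ η ≤ 0 then (1 : ℂ) else 0) = 0 := if_neg fun h' => hξ0 h'.1
    have hS : ∑ p : Fin m × Fin (d + 1), A p.1 p.2 ξ * conj (Cf p.1 p.2 η) = 0 :=
      Finset.sum_eq_zero fun p _ => by
        rw [hA _ _ _ fun h' => hξ0 (lt_of_le_of_lt (by positivity) h'.1), zero_mul]
    rw [hK, hS, mul_zero, mul_zero, sub_zero, norm_zero, zero_pow two_ne_zero, ENNReal.ofReal_zero]
    exact bot_le
  have hKq : (if 0 < ξ ∧ η ≤ 0 then (1 : ℂ) else 0) = 1 := if_pos ⟨hξ0, hη⟩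
  rw [hKq, mul_one]
  by_cases hξm : ξ ≤ m * h
  · -- the strip `0 < ξ ≤ mh`: box-Taylor remainder
    obtain ⟨j, hjm, hjξ⟩ := exists_box_index hh hξ0 hξm
    have hS : ∑ p : Fin m × Fin (d + 1), A p.1 p.2 ξ * conj (Cf p.1 p.2 η) =
        ∑ l ∈ Finset.range (d + 1),
          (-2) * ((((l ! : ℝ)⁻¹ * (ξ - j * h) ^ l : ℝ) : ℂ) * iteratedDeriv l g (j * h - η)) := by
      calc ∑ p : Fin m × Fin (d + 1), A p.1 p.2 ξ * conj (Cf p.1 p.2 η)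
          = ∑ j' : Fin m, ∑ l : Fin (d + 1), A j' l ξ * conj (Cf j' l η) := Fintype.sum_prod_type _
        _ = ∑ l : Fin (d + 1), A j l ξ * conj (Cf j l η) := by
            refine Finset.sum_eq_single (⟨j, hjm⟩ : Fin m) ?_ (fun h' => (h' (Finset.mem_univ _)).elim)
            intro j' _ hj'
            refine Finset.sum_eq_zero fun l _ => ?_
            rw [hA _ _ _ fun h' => hj' (Fin.ext (box_index_unique hh h' hjξ)), zero_mul]
        _ = ∑ l : Fin (d + 1),
              (-2) * (((((l : ℕ) ! : ℝ)⁻¹ * (ξ - j * h) ^ (l : ℕ) : ℝ) : ℂ) * iteratedDeriv l g (j * h - η)) :=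
            Finset.sum_congr rfl fun l _ => hAC j l ξ η hjξ hη
        _ = _ := Fin.sum_univ_eq_sum_range (fun l => (-2) * ((((l ! : ℝ)⁻¹ * (ξ - j * h) ^ l : ℝ) : ℂ) *
            iteratedDeriv l g (j * h - η))) (d + 1)
    have h1 := hC j h ξ η hh hjξ hη
    rw [← hS] at h1
    have h2 : ‖(-2) * (g : ℝ → ℂ) (ξ - η) - ∑ p : Fin m × Fin (d + 1), A p.1 p.2 ξ * conj (Cf p.1 p.2 η)‖ ^ 2
        ≤ (2 * C * h ^ (d + 1)) ^ 2 * ((1 + |η|) ^ 2)⁻¹ := by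
      calc _ ≤ (2 * C * h ^ (d + 1) * ((1 + |η|) ^ 1)⁻¹) ^ 2 := pow_le_pow_left₀ (norm_nonneg _) h1 2
        _ = (2 * C * h ^ (d + 1)) ^ 2 * ((1 + |η|) ^ 2)⁻¹ := by rw [pow_one, mul_pow, inv_pow]
    have hmem : ξ ∈ Ioc (0 : ℝ) (m * h) := ⟨hξ0, hξm⟩
    have hnmem : ξ ∉ Ioi ((m : ℝ) * h) := fun h' => not_lt.2 hξm h'
    rw [indicator_of_mem hmem, indicator_of_notMem hnmem, add_zero, ← ENNReal.ofReal_mul (by positivity)]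
    exact ENNReal.ofReal_le_ofReal h2
  · -- the tail `ξ > mh`: decay of `g`
    have hξm' : (m : ℝ) * h < ξ := lt_of_not_ge hξm
    have hS : ∑ p : Fin m × Fin (d + 1), A p.1 p.2 ξ * conj (Cf p.1 p.2 η) = 0 := by
      refine Finset.sum_eq_zero fun p _ => ?_
      have hp : ((p.1 : ℕ) : ℝ) * h + h ≤ m * h := by
        have : ((p.1 : ℕ) : ℝ) + 1 ≤ m := by exact_mod_cast Nat.succ_le_of_lt p.1.isLt
        nlinarith
      rw [hA _ _ _ fun h' => not_lt.2 (h'.2.trans hp) hξm', zero_mul]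
    rw [hS, sub_zero]
    have habs : |ξ - η| = |ξ| + |η| := by
      rw [abs_of_pos hξ0, abs_of_nonpos hη, abs_of_pos (by linarith)]; ring
    have hg := hM (ξ - η)
    have hξabs : (m : ℝ) * h ≤ |ξ| := by rw [abs_of_pos hξ0]; exact hξm'.le
    have hmh : 0 ≤ (m : ℝ) * h := by positivity
    -- the decay factor splits
    have hdec : (((1 + |ξ - η|) ^ P)⁻¹) ^ 2 ≤
        ((1 + m * h) ^ (P - 2))⁻¹ * ((1 + |ξ|) ^ 2)⁻¹ * ((1 + |η|) ^ 2)⁻¹ := by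
      rw [habs, sq]
      have hP' : P - 2 + 2 = P := Nat.sub_add_cancel hP
      have hx1 : (1 + |ξ|) ^ P ≤ (1 + (|ξ| + |η|)) ^ P :=
        pow_le_pow_left₀ (by positivity) (by linarith [abs_nonneg η]) P
      have hx2 : (1 + |η|) ^ P ≤ (1 + (|ξ| + |η|)) ^ P :=
        pow_le_pow_left₀ (by positivity) (by linarith [abs_nonneg ξ]) P
      have hx3 : (1 + (m : ℝ) * h) ^ (P - 2) * (1 + |ξ|) ^ 2 ≤ (1 + |ξ|) ^ P :=
        calc (1 + (m : ℝ) * h) ^ (P - 2) * (1 + |ξ|) ^ 2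
            ≤ (1 + |ξ|) ^ (P - 2) * (1 + |ξ|) ^ 2 := by gcongr
          _ = (1 + |ξ|) ^ P := by rw [← pow_add, hP']
      have hx4 : (1 + |η|) ^ 2 ≤ (1 + |η|) ^ P := pow_le_pow_right₀ (by linarith [abs_nonneg η]) hP
      calc ((1 + (|ξ| + |η|)) ^ P)⁻¹ * ((1 + (|ξ| + |η|)) ^ P)⁻¹
          ≤ ((1 + |ξ|) ^ P)⁻¹ * ((1 + |η|) ^ P)⁻¹ :=
            mul_le_mul (inv_anti₀ (by positivity) hx1) (inv_anti₀ (by positivity) hx2)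
              (by positivity) (by positivity)
        _ ≤ ((1 + m * h) ^ (P - 2) * (1 + |ξ|) ^ 2)⁻¹ * ((1 + |η|) ^ 2)⁻¹ :=
            mul_le_mul (inv_anti₀ (by positivity) hx3) (inv_anti₀ (by positivity) hx4)
              (by positivity) (by positivity)
        _ = _ := by rw [mul_inv]
    have h2 : ‖(-2) * (g : ℝ → ℂ) (ξ - η)‖ ^ 2 ≤
        4 * M ^ 2 * ((1 + m * h) ^ (P - 2))⁻¹ * ((1 + |ξ|) ^ 2)⁻¹ * ((1 + |η|) ^ 2)⁻¹ := by
      rw [norm_mul, show ‖(-2 : ℂ)‖ = 2 by simp, mul_pow]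
      calc (2 : ℝ) ^ 2 * ‖(g : ℝ → ℂ) (ξ - η)‖ ^ 2 ≤ 2 ^ 2 * (M * ((1 + |ξ - η|) ^ P)⁻¹) ^ 2 := by
            gcongr
        _ = 4 * M ^ 2 * (((1 + |ξ - η|) ^ P)⁻¹) ^ 2 := by ring
        _ ≤ 4 * M ^ 2 * (((1 + m * h) ^ (P - 2))⁻¹ * ((1 + |ξ|) ^ 2)⁻¹ * ((1 + |η|) ^ 2)⁻¹) := by
            gcongr
        _ = _ := by ring
    have hmem : ξ ∈ Ioi ((m : ℝ) * h) := hξm'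
    have hnmem : ξ ∉ Ioc (0 : ℝ) (m * h) := fun h' => hξm h'.2
    rw [indicator_of_notMem hnmem, indicator_of_mem hmem, zero_add, ← ENNReal.ofReal_mul (by positivity)]
    exact ENNReal.ofReal_le_ofReal h2

/-- RH-FREE. **The `L²(ℝ²)` error of the structured separable approximant** (Tonelli on the product weight of
`ofReal_normSq_quadrant_sub_pieces_le`): `∫∫ |K − K_{m,h}|² ≤ (4C²h^{2d+2}·mh + 4M²(1+mh)^{2−P}·I)·I` with
`I = ∫(1+|x|)^{−2}`.  [cite: ConnesConsani2021, App. D Rem. 48 p. 33 (arXiv chunk p0033:L39–41)] -/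
theorem lintegral_normSq_quadrant_sub_pieces_le (g : SchwartzMap ℝ ℂ) (d P : ℕ) (hP : 2 ≤ P)
    {C : ℝ}
    (hC : ∀ (j : ℕ) (h ξ η : ℝ), 0 < h → ξ ∈ Ioc ((j : ℝ) * h) ((j : ℝ) * h + h) → η ≤ 0 →
      ‖(-2) * (g : ℝ → ℂ) (ξ - η) - ∑ l ∈ Finset.range (d + 1),
          (-2) * ((((l ! : ℝ)⁻¹ * (ξ - j * h) ^ l : ℝ) : ℂ) * iteratedDeriv l g (j * h - η))‖
        ≤ 2 * C * h ^ (d + 1) * ((1 + |η|) ^ 1)⁻¹)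
    {M : ℝ} (hM : ∀ w : ℝ, ‖(g : ℝ → ℂ) w‖ ≤ M * ((1 + |w|) ^ P)⁻¹)
    {I : ℝ} (hI0 : 0 ≤ I) (hI : ∫⁻ x : ℝ, ENNReal.ofReal (((1 + |x|) ^ 2)⁻¹) = ENNReal.ofReal I)
    (m : ℕ) {h : ℝ} (hh : 0 < h)
    (A Cf : ℕ → ℕ → ℝ → ℂ)
    (hA : ∀ (j l : ℕ) (ξ : ℝ), ξ ∉ Ioc ((j : ℝ) * h) ((j : ℝ) * h + h) → A j l ξ = 0)
    (hCf : ∀ (j l : ℕ) (η : ℝ), 0 < η → Cf j l η = 0)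
    (hAC : ∀ (j l : ℕ) (ξ η : ℝ), ξ ∈ Ioc ((j : ℝ) * h) ((j : ℝ) * h + h) → η ≤ 0 →
      A j l ξ * conj (Cf j l η) =
        (-2) * ((((l ! : ℝ)⁻¹ * (ξ - j * h) ^ l : ℝ) : ℂ) * iteratedDeriv l g (j * h - η))) :
    ∫⁻ z : ℝ × ℝ, ENNReal.ofReal (‖(-2) * ((g : ℝ → ℂ) (z.1 - z.2) *
        (if 0 < z.1 ∧ z.2 ≤ 0 then (1 : ℂ) else 0)) -
        ∑ p : Fin m × Fin (d + 1), A p.1 p.2 z.1 * conj (Cf p.1 p.2 z.2)‖ ^ 2) ∂((volume : Measure ℝ).prod volume)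
      ≤ ENNReal.ofReal (((2 * C * h ^ (d + 1)) ^ 2 * (m * h) +
          4 * M ^ 2 * ((1 + m * h) ^ (P - 2))⁻¹ * I) * I) := by
  set c₁ : ℝ := (2 * C * h ^ (d + 1)) ^ 2 with hc₁
  set c₂ : ℝ := 4 * M ^ 2 * ((1 + m * h) ^ (P - 2))⁻¹ with hc₂
  have hc₁0 : 0 ≤ c₁ := by positivity
  have hc₂0 : 0 ≤ c₂ := by positivity
  set W : ℝ → ℝ≥0∞ := fun x => ENNReal.ofReal (((1 + |x|) ^ 2)⁻¹) with hW
  set Φ : ℝ → ℝ≥0∞ := fun ξ => (Ioc (0 : ℝ) (m * h)).indicator (fun _ => ENNReal.ofReal c₁) ξ +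
    (Ioi ((m : ℝ) * h)).indicator (fun ξ => ENNReal.ofReal (c₂ * ((1 + |ξ|) ^ 2)⁻¹)) ξ with hΦ
  have hWm : Measurable W := measurable_weight
  have hΦ1m : Measurable fun ξ : ℝ => (Ioc (0 : ℝ) (m * h)).indicator (fun _ => ENNReal.ofReal c₁) ξ :=
    measurable_const.indicator measurableSet_Ioc
  have hΦ2m : Measurable fun ξ : ℝ =>
      (Ioi ((m : ℝ) * h)).indicator (fun ξ => ENNReal.ofReal (c₂ * ((1 + |ξ|) ^ 2)⁻¹)) ξ :=
    (ENNReal.measurable_ofReal.comp (by fun_prop)).indicator measurableSet_Ioi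
  have hΦm : Measurable Φ := hΦ1m.add hΦ2m
  -- pointwise bound and Tonelli
  have hpt : ∀ z : ℝ × ℝ, ENNReal.ofReal (‖(-2) * ((g : ℝ → ℂ) (z.1 - z.2) *
      (if 0 < z.1 ∧ z.2 ≤ 0 then (1 : ℂ) else 0)) -
      ∑ p : Fin m × Fin (d + 1), A p.1 p.2 z.1 * conj (Cf p.1 p.2 z.2)‖ ^ 2) ≤ Φ z.1 * W z.2 :=
    fun z => ofReal_normSq_quadrant_sub_pieces_le g d P hP hC hM m hh A Cf hA hCf hAC z.1 z.2
  have hprod : ∫⁻ z : ℝ × ℝ, Φ z.1 * W z.2 ∂((volume : Measure ℝ).prod volume) =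
      (∫⁻ ξ, Φ ξ) * ∫⁻ η, W η := lintegral_prod_mul hΦm.aemeasurable hWm.aemeasurable
  -- the `ξ`-integral of `Φ`
  have hΦint : ∫⁻ ξ, Φ ξ ≤ ENNReal.ofReal (c₁ * (m * h)) + ENNReal.ofReal c₂ * ENNReal.ofReal I := by
    rw [hΦ, lintegral_add_left hΦ1m, lintegral_indicator_const measurableSet_Ioc, Real.volume_Ioc, sub_zero,
      ← ENNReal.ofReal_mul hc₁0, lintegral_indicator measurableSet_Ioi]
    gcongr
    calc ∫⁻ ξ in Ioi ((m : ℝ) * h), ENNReal.ofReal (c₂ * ((1 + |ξ|) ^ 2)⁻¹)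
        ≤ ∫⁻ ξ, ENNReal.ofReal (c₂ * ((1 + |ξ|) ^ 2)⁻¹) := setLIntegral_le_lintegral _ _
      _ = ∫⁻ ξ, ENNReal.ofReal c₂ * W ξ := by
          refine lintegral_congr fun ξ => ?_
          rw [ENNReal.ofReal_mul hc₂0]
      _ = ENNReal.ofReal c₂ * ENNReal.ofReal I := by rw [lintegral_const_mul _ hWm, ← hI]
  calc ∫⁻ z : ℝ × ℝ, ENNReal.ofReal (‖(-2) * ((g : ℝ → ℂ) (z.1 - z.2) *
        (if 0 < z.1 ∧ z.2 ≤ 0 then (1 : ℂ) else 0)) -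
        ∑ p : Fin m × Fin (d + 1), A p.1 p.2 z.1 * conj (Cf p.1 p.2 z.2)‖ ^ 2) ∂((volume : Measure ℝ).prod volume)
      ≤ ∫⁻ z : ℝ × ℝ, Φ z.1 * W z.2 ∂((volume : Measure ℝ).prod volume) := lintegral_mono hpt
    _ = (∫⁻ ξ, Φ ξ) * ∫⁻ η, W η := hprod
    _ ≤ (ENNReal.ofReal (c₁ * (m * h)) + ENNReal.ofReal c₂ * ENNReal.ofReal I) * ENNReal.ofReal I := by
        rw [show (∫⁻ η, W η) = ENNReal.ofReal I from hI]
        gcongr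
    _ = ENNReal.ofReal ((c₁ * (m * h) + c₂ * I) * I) := by
        rw [← ENNReal.ofReal_mul hc₂0, ← ENNReal.ofReal_add (by positivity) (by positivity),
          ← ENNReal.ofReal_mul (by positivity)]

/-! ### The theorem: one quadrant, any Schwartz `g`, rate `(n+1)^{−k}` for every `k` -/

/-- RH-FREE. **Separable `L²(ℝ²)`-approximation of the quadrant kernel `−2 g(ξ−η) 1_{ξ>0≥η}` at a
super-polynomial rate** (the "direct kernel estimate" of App. D Rem. 48 for one off-diagonal quadrant and an
arbitrary Schwartz function `g`; with `g = 𝓕 f` and its reflection this is the hypothesis of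
`isInfiniteOrder_quantizedDiff_of_frequencyKernelApprox`, i.e. the infinite-order clause of App. D Lemma 47):
for every `k` there is `C` such that for every `n` there are `a_i, c_i ∈ L²(ℝ)`, `i < n`, with
`‖−2 g(ξ−η)1_{ξ>0}1_{η≤0} − Σ_{i<n} a_i(ξ) conj(c_i(η))‖_{L²(ℝ²)} · (n+1)^k ≤ C`.  Proof: box-Taylor pieces
(`FrequencyKernelApproxPieces`) with `d = 2k`, decay exponent `P = 4k+2`, `m = ⌊n/(2k+1)⌋` boxes of width
`h = (m+1)^{−1/2}`, and `lintegral_normSq_quadrant_sub_pieces_le`.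
[cite: ConnesConsani2021, App. D Lemma 47 proof p. 33 (arXiv chunk p0033:L24–36) and Rem. 48 (L39–41)] -/
theorem quadrantKernel_separableApprox (g : SchwartzMap ℝ ℂ) (k : ℕ) :
    ∃ C : ℝ, ∀ n : ℕ, ∃ a c : Fin n → Lp (α := ℝ) ℂ 2,
      Real.sqrt (∫ z : ℝ × ℝ, ‖(-2) * ((g : ℝ → ℂ) (z.1 - z.2) * (if 0 < z.1 ∧ z.2 ≤ 0 then (1 : ℂ) else 0)) -
          ∑ i, (a i : ℝ → ℂ) z.1 * (starRingEnd ℂ) ((c i : ℝ → ℂ) z.2)‖ ^ 2 ∂((volume : Measure ℝ).prod volume))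
        * ((n : ℝ) + 1) ^ k ≤ C := by
  -- the constants: Taylor remainder (degree `2k`, decay `1`), decay of `g` (exponent `4k+2`), `∫(1+|x|)⁻²`
  have hP2 : 2 ≤ 4 * k + 2 := by omega
  obtain ⟨C, hC0, hC⟩ := norm_quadrantKernel_sub_boxTaylor_le g (2 * k) 1
  obtain ⟨M, hM0, hM⟩ := SchwartzMap.norm_iteratedDeriv_le_inv_one_add_pow g (4 * k + 2) 0
  simp only [iteratedDeriv_zero] at hM
  obtain ⟨I, hI0, hI⟩ := exists_lintegral_inv_one_add_abs_sq
  set K₀ : ℝ := Real.sqrt (4 * C ^ 2 * I + 4 * M ^ 2 * I ^ 2) with hK₀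
  have hK₀0 : 0 ≤ K₀ := Real.sqrt_nonneg _
  have hK₀sq : K₀ ^ 2 = 4 * C ^ 2 * I + 4 * M ^ 2 * I ^ 2 := Real.sq_sqrt (by positivity)
  refine ⟨K₀ * (((2 * k : ℕ) : ℝ) + 1) ^ k, fun n => ?_⟩
  -- `m = ⌊n/(2k+1)⌋` boxes, `m (2k+1) ≤ n`, `n + 1 ≤ (2k+1)(m+1)`
  set m : ℕ := n / (2 * k + 1) with hm
  have hcard : Fintype.card (Fin m × Fin (2 * k + 1)) ≤ n := by
    rw [Fintype.card_prod, Fintype.card_fin, Fintype.card_fin]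
    exact Nat.div_mul_le_self n (2 * k + 1)
  have hn1 : (n : ℝ) + 1 ≤ (((2 * k : ℕ) : ℝ) + 1) * ((m : ℝ) + 1) := by
    have h1 : (2 * k + 1) * m + n % (2 * k + 1) = n := by rw [hm]; exact Nat.div_add_mod n (2 * k + 1)
    have h2 : n % (2 * k + 1) < 2 * k + 1 := Nat.mod_lt n (by omega)
    have h3 : n + 1 ≤ (2 * k + 1) * (m + 1) := by rw [Nat.mul_succ]; omega
    exact_mod_cast h3
  -- box width `h = r⁻¹`, `r = √(m+1)`
  set r : ℝ := Real.sqrt ((m : ℝ) + 1) with hr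
  have hm1 : (1 : ℝ) ≤ (m : ℝ) + 1 := by
    have := (Nat.cast_nonneg m : (0 : ℝ) ≤ m); linarith
  have hr1 : 1 ≤ r := Real.one_le_sqrt.2 hm1
  have hr0 : 0 < r := by positivity
  have hr0' : r ≠ 0 := hr0.ne'
  have hrsq : r ^ 2 = (m : ℝ) + 1 := Real.sq_sqrt (by positivity)
  set h : ℝ := r⁻¹ with hh
  have hh0 : 0 < h := inv_pos.2 hr0
  have hh1 : h ≤ 1 := inv_le_one_of_one_le₀ hr1
  have hmh : r = (m : ℝ) * h + h := by
    have : ((m : ℝ) + 1) * h = r := by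
      rw [← hrsq, hh, sq, mul_assoc, mul_inv_cancel₀ hr0.ne', mul_one]
    linarith
  -- the explicit pieces
  set A : ℕ → ℕ → ℝ → ℂ := fun j l ξ =>
    (-2) * (((l ! : ℝ) : ℂ))⁻¹ * (((ξ - j * h) ^ l : ℝ) : ℂ) *
      (Ioc ((j : ℝ) * h) ((j : ℝ) * h + h)).indicator (fun _ => (1 : ℂ)) ξ with hAdef
  set Cf : ℕ → ℕ → ℝ → ℂ := fun j l η =>
    conj (iteratedDeriv l g (j * h - η)) * (Iic (0 : ℝ)).indicator (fun _ => (1 : ℂ)) η with hCfdef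
  have hA : ∀ (j l : ℕ) (ξ : ℝ), ξ ∉ Ioc ((j : ℝ) * h) ((j : ℝ) * h + h) → A j l ξ = 0 :=
    fun j l ξ hξ => by simp only [hAdef, indicator_of_notMem hξ, mul_zero]
  have hCf : ∀ (j l : ℕ) (η : ℝ), 0 < η → Cf j l η = 0 := fun j l η hη => by
    have hη' : η ∉ Iic (0 : ℝ) := fun h' => not_le.2 hη h'
    simp only [hCfdef, indicator_of_notMem hη', mul_zero]
  have hAC : ∀ (j l : ℕ) (ξ η : ℝ), ξ ∈ Ioc ((j : ℝ) * h) ((j : ℝ) * h + h) → η ≤ 0 →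
      A j l ξ * conj (Cf j l η) =
        (-2) * ((((l ! : ℝ)⁻¹ * (ξ - j * h) ^ l : ℝ) : ℂ) * iteratedDeriv l g (j * h - η)) := by
    intro j l ξ η hξ hη
    have hη' : η ∈ Iic (0 : ℝ) := hη
    simp only [hAdef, hCfdef, indicator_of_mem hξ, indicator_of_mem hη', mul_one, Complex.conj_conj]
    push_cast
    ring
  -- the pieces are in `L²`
  have hAmem : ∀ j l : ℕ, MemLp (A j l) 2 (volume : Measure ℝ) := fun j l =>
    memLp_two_boxMonomial ((j : ℝ) * h) h l ((-2) * (((l ! : ℝ) : ℂ))⁻¹)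
  have hCmem : ∀ j l : ℕ, MemLp (Cf j l) 2 (volume : Measure ℝ) := fun j l =>
    memLp_two_schwartzDeriv_reflect g ((j : ℝ) * h) l
  set a₀ : Fin m × Fin (2 * k + 1) → Lp (α := ℝ) ℂ 2 := fun p => (hAmem p.1 p.2).toLp _ with ha₀
  set c₀ : Fin m × Fin (2 * k + 1) → Lp (α := ℝ) ℂ 2 := fun p => (hCmem p.1 p.2).toLp _ with hc₀
  have hae₀ : (fun z : ℝ × ℝ => ∑ p, (a₀ p : ℝ → ℂ) z.1 * conj ((c₀ p : ℝ → ℂ) z.2))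
      =ᵐ[(volume : Measure ℝ).prod volume]
      fun z => ∑ p : Fin m × Fin (2 * k + 1), A p.1 p.2 z.1 * conj (Cf p.1 p.2 z.2) := by
    have h1 : ∀ᵐ x ∂(volume : Measure ℝ), ∀ p : Fin m × Fin (2 * k + 1),
        (a₀ p : ℝ → ℂ) x = A p.1 p.2 x :=
      ae_all_iff.2 fun p => (hAmem p.1 p.2).coeFn_toLp
    have h2 : ∀ᵐ y ∂(volume : Measure ℝ), ∀ p : Fin m × Fin (2 * k + 1),
        (c₀ p : ℝ → ℂ) y = Cf p.1 p.2 y :=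
      ae_all_iff.2 fun p => (hCmem p.1 p.2).coeFn_toLp
    filter_upwards [(Measure.quasiMeasurePreserving_fst (μ := (volume : Measure ℝ))
        (ν := (volume : Measure ℝ))).ae h1,
      (Measure.quasiMeasurePreserving_snd (μ := (volume : Measure ℝ))
        (ν := (volume : Measure ℝ))).ae h2] with z hz1 hz2
    exact Finset.sum_congr rfl fun p _ => by rw [hz1 p, hz2 p]
  -- pad to `Fin n`
  obtain ⟨a, c, hpad⟩ := exists_fin_separable_ae_eq hcard a₀ c₀
  refine ⟨a, c, ?_⟩
  have hint_eq : (∫ z : ℝ × ℝ, ‖(-2) * ((g : ℝ → ℂ) (z.1 - z.2) *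
        (if 0 < z.1 ∧ z.2 ≤ 0 then (1 : ℂ) else 0)) -
        ∑ i, (a i : ℝ → ℂ) z.1 * (starRingEnd ℂ) ((c i : ℝ → ℂ) z.2)‖ ^ 2 ∂((volume : Measure ℝ).prod volume))
      = ∫ z : ℝ × ℝ, ‖(-2) * ((g : ℝ → ℂ) (z.1 - z.2) * (if 0 < z.1 ∧ z.2 ≤ 0 then (1 : ℂ) else 0)) -
        ∑ p : Fin m × Fin (2 * k + 1), A p.1 p.2 z.1 * conj (Cf p.1 p.2 z.2)‖ ^ 2
          ∂((volume : Measure ℝ).prod volume) := by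
    refine integral_congr_ae ?_
    filter_upwards [hpad, hae₀] with z h1 h2
    rw [h1, h2]
  -- the explicit `L²` bound and its simplification to `K₀² (m+1)^{−2k}`
  have hlin := lintegral_normSq_quadrant_sub_pieces_le g (2 * k) (4 * k + 2) hP2 hC hM hI0 hI m hh0
    A Cf hA hCf hAC
  set B : ℝ := ((2 * C * h ^ (2 * k + 1)) ^ 2 * (m * h) +
    4 * M ^ 2 * ((1 + m * h) ^ (4 * k + 2 - 2))⁻¹ * I) * I with hB
  have hB0 : 0 ≤ B := by positivity
  have hs : (r ^ (4 * k))⁻¹ = (((m : ℝ) + 1) ^ (2 * k))⁻¹ := by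
    rw [← hrsq, ← pow_mul, show 2 * (2 * k) = 4 * k by ring]
  have ht1 : (2 * C * h ^ (2 * k + 1)) ^ 2 * (m * h) * I ≤ 4 * C ^ 2 * I * (r ^ (4 * k))⁻¹ := by
    have e1 : (2 * C * h ^ (2 * k + 1)) ^ 2 * (m * h) * I = 4 * C ^ 2 * I * (m * h ^ (4 * k + 3)) := by
      ring
    rw [e1]
    have e2 : (m : ℝ) * h ^ (4 * k + 3) ≤ (r ^ (4 * k))⁻¹ := by
      calc (m : ℝ) * h ^ (4 * k + 3) ≤ ((m : ℝ) + 1) * h ^ (4 * k + 3) := by gcongr; linarith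
        _ = (r ^ (4 * k + 1))⁻¹ := by
            rw [← hrsq, hh, inv_pow]
            field_simp
            ring
        _ ≤ (r ^ (4 * k))⁻¹ := inv_anti₀ (by positivity) (pow_le_pow_right₀ hr1 (by omega))
    gcongr
  have ht2 : 4 * M ^ 2 * ((1 + m * h) ^ (4 * k + 2 - 2))⁻¹ * I * I ≤
      4 * M ^ 2 * I ^ 2 * (r ^ (4 * k))⁻¹ := by
    have e1 : 4 * k + 2 - 2 = 4 * k := by omega
    rw [e1]
    have e2 : ((1 + (m : ℝ) * h) ^ (4 * k))⁻¹ ≤ (r ^ (4 * k))⁻¹ :=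
      inv_anti₀ (by positivity) (pow_le_pow_left₀ hr0.le (by linarith) _)
    calc 4 * M ^ 2 * ((1 + (m : ℝ) * h) ^ (4 * k))⁻¹ * I * I
        = 4 * M ^ 2 * I ^ 2 * ((1 + (m : ℝ) * h) ^ (4 * k))⁻¹ := by ring
      _ ≤ 4 * M ^ 2 * I ^ 2 * (r ^ (4 * k))⁻¹ := by gcongr
  have hBle : B ≤ (K₀ * ((((m : ℝ) + 1) ^ k)⁻¹)) ^ 2 := by
    calc B = (2 * C * h ^ (2 * k + 1)) ^ 2 * (m * h) * I +
          4 * M ^ 2 * ((1 + m * h) ^ (4 * k + 2 - 2))⁻¹ * I * I := by rw [hB]; ring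
      _ ≤ 4 * C ^ 2 * I * (r ^ (4 * k))⁻¹ + 4 * M ^ 2 * I ^ 2 * (r ^ (4 * k))⁻¹ := add_le_add ht1 ht2
      _ = K₀ ^ 2 * (((m : ℝ) + 1) ^ (2 * k))⁻¹ := by rw [hK₀sq, hs]; ring
      _ = (K₀ * ((((m : ℝ) + 1) ^ k)⁻¹)) ^ 2 := by rw [mul_pow, inv_pow, ← pow_mul, mul_comm k 2]
  -- the real integral is bounded by `B`
  have hT : (∫ z : ℝ × ℝ, ‖(-2) * ((g : ℝ → ℂ) (z.1 - z.2) * (if 0 < z.1 ∧ z.2 ≤ 0 then (1 : ℂ) else 0)) -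
      ∑ p : Fin m × Fin (2 * k + 1), A p.1 p.2 z.1 * conj (Cf p.1 p.2 z.2)‖ ^ 2
        ∂((volume : Measure ℝ).prod volume)) ≤ B := by
    by_cases hi : Integrable (fun z : ℝ × ℝ => ‖(-2) * ((g : ℝ → ℂ) (z.1 - z.2) *
        (if 0 < z.1 ∧ z.2 ≤ 0 then (1 : ℂ) else 0)) -
        ∑ p : Fin m × Fin (2 * k + 1), A p.1 p.2 z.1 * conj (Cf p.1 p.2 z.2)‖ ^ 2)
        ((volume : Measure ℝ).prod volume)
    · have heq := ofReal_integral_eq_lintegral_ofReal hi (ae_of_all _ fun z => by positivity)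
      rw [← ENNReal.ofReal_le_ofReal_iff hB0, heq]
      exact hlin
    · rw [integral_undef hi]; exact hB0
  have hsqrt : Real.sqrt (∫ z : ℝ × ℝ, ‖(-2) * ((g : ℝ → ℂ) (z.1 - z.2) *
      (if 0 < z.1 ∧ z.2 ≤ 0 then (1 : ℂ) else 0)) -
      ∑ i, (a i : ℝ → ℂ) z.1 * (starRingEnd ℂ) ((c i : ℝ → ℂ) z.2)‖ ^ 2 ∂((volume : Measure ℝ).prod volume))
        ≤ K₀ * ((((m : ℝ) + 1) ^ k)⁻¹) := by
    rw [hint_eq, Real.sqrt_le_left (by positivity)]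
    exact hT.trans hBle
  -- conclusion: `√(∫…)·(n+1)^k ≤ K₀ (m+1)^{−k} ((2k+1)(m+1))^k = K₀ (2k+1)^k`
  have hmk : (((m : ℝ) + 1) ^ k) ≠ 0 := by positivity
  calc Real.sqrt (∫ z : ℝ × ℝ, ‖(-2) * ((g : ℝ → ℂ) (z.1 - z.2) *
        (if 0 < z.1 ∧ z.2 ≤ 0 then (1 : ℂ) else 0)) -
        ∑ i, (a i : ℝ → ℂ) z.1 * (starRingEnd ℂ) ((c i : ℝ → ℂ) z.2)‖ ^ 2 ∂((volume : Measure ℝ).prod volume))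
        * ((n : ℝ) + 1) ^ k
      ≤ K₀ * ((((m : ℝ) + 1) ^ k)⁻¹) * ((((2 * k : ℕ) : ℝ) + 1) * ((m : ℝ) + 1)) ^ k :=
        mul_le_mul hsqrt (pow_le_pow_left₀ (by positivity) hn1 k) (by positivity) (by positivity)
    _ = K₀ * (((2 * k : ℕ) : ℝ) + 1) ^ k := by
        rw [mul_pow]
        field_simp

end Literature.NumberTheory.ConnesConsani2021
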